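import Summits.CriticalPhenomena.PercolationContinuityZ3.Theorems.PercNearOneGluingNoHeavyQuantTLBClosure
import Summits.CriticalPhenomena.PercolationContinuityZ3.Theorems.PercNearOneGluingNoHeavyQuantHeavyRegimeM
import Summits.CriticalPhenomena.PercolationContinuityZ3.Theorems.PercNearOneGluingNoHeavyQuantHeavyRegimeR
import Summits.CriticalPhenomena.PercolationContinuityZ3.Theorems.PercNearOneGluingNoHeavyQuantGatedConvSplit
import HarnessLib

/-!
# QUANT lane R8: the heavy depth-0 closure, UNFOLDED — `gate_q(μ₁ ∗ μ₂)` satisfies the two-layer-bound family `TLB` at every floor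
# `1/2 ≤ y < 1` whenever the gated factors do (`LawDec.tlb_gate_lconv_of_heavy`)

builds on p205010 (kernel theorem, internal audit signed; external expert review pending)

Support file (`--supports stmt-CriticalPhenomena-4575`), QUANT lane typer seat prim-quant-stmt (gen 34).  Theorems only, standard axioms, no
sorries.  This is LITERALLY the body of the `@[conjecture] def LawDec.TLBGateConvClosedHeavy` (`…QuantTLBClosureHeavy`, lead g37, ⧗ p376241)
proved as a theorem, so that the mathematics is in the tree independently of that statement file; the named node and `Quant.FarTreeRowHeavy`
follow by `Iff.rfl`-style wrappers (`…QuantHeavyHolds`).  Row `d` of the conclusion: `d < q·min(T₁,T₂)` → `gate_lconv_row_of_lt_min`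
(regime M, pure tilts, `…QuantHeavyRegimeM`); `q·T₂ ≤ d` → `gate_lconv_row_of_ge_right` (regime R, arm-2's S* + upper rows,
`…QuantHeavyRegimeR`); `q·T₁ ≤ d` → the same after `lconv_comm` (`…QuantGatedConvSplit`).
Memo `run/shared/lean/prim/quant/prim-quant-stmt-g34/PHANTOM-QFREE-G34.md`; explicit certificate checked exactly on 1 130 452 instances (kit j218836).

[this work].  The gluing rows served [cite: KozmaNitzan2024, Conjecture 3 (p. 15)]; product measure [cite: Grimmett1999, §1.3 p. 10].
-/

noncomputable section

namespace Summit.CriticalPhenomena.PercolationContinuityZ3.Theorems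

namespace Quant

open Finset

namespace LawDec

/-- **THE HEAVY DEPTH-0 CLOSURE (unfolded form of `TLBGateConvClosedHeavy`).**  For a floor `1/2 ≤ y < 1`, one gate `0 < q ≤ 1` and
probability laws `μ₁`, `μ₂` on `{0..M₁}`, `{0..M₂}` whose gated versions are top-affordable at `y` and satisfy
`TLB (y/(1−y)) (q·Tᵢ) Mᵢ (gate μᵢ q)`, the gated convolution satisfies `TLB (y/(1−y)) (q(T₁+T₂)) (M₁+M₂) (gate (lconv μ₁ μ₂) q)`.
(Top-affordability is not even used.) [this work] -/
theorem tlb_gate_lconv_of_heavy (y q : ℝ) (M₁ M₂ : ℕ) (μ₁ μ₂ : ℕ → ℝ)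
    (hy : 1 / 2 ≤ y) (hy1 : y < 1) (hq0 : 0 < q) (hq1 : q ≤ 1)
    (n1 : ∀ h, 0 ≤ μ₁ h) (z1 : ∀ h, M₁ < h → μ₁ h = 0) (s1 : ∑ h ∈ Finset.range (M₁ + 1), μ₁ h = 1)
    (t1 : y * (M₁ : ℝ) ≤ q * ∑ h ∈ Finset.range (M₁ + 1), (h : ℝ) * μ₁ h)
    (n2 : ∀ h, 0 ≤ μ₂ h) (z2 : ∀ h, M₂ < h → μ₂ h = 0) (s2 : ∑ h ∈ Finset.range (M₂ + 1), μ₂ h = 1)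
    (t2 : y * (M₂ : ℝ) ≤ q * ∑ h ∈ Finset.range (M₂ + 1), (h : ℝ) * μ₂ h)
    (c1 : TLB (y / (1 - y)) (q * ∑ h ∈ Finset.range (M₁ + 1), (h : ℝ) * μ₁ h) M₁ (gate μ₁ q))
    (c2 : TLB (y / (1 - y)) (q * ∑ h ∈ Finset.range (M₂ + 1), (h : ℝ) * μ₂ h) M₂ (gate μ₂ q)) :
    TLB (y / (1 - y)) (q * ((∑ h ∈ Finset.range (M₁ + 1), (h : ℝ) * μ₁ h) + ∑ h ∈ Finset.range (M₂ + 1), (h : ℝ) * μ₂ h))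
      (M₁ + M₂) (gate (lconv M₁ M₂ μ₁ μ₂) q) := by
  intro d hd
  have hy0 : 0 < y := by linarith
  by_cases h1 : (d : ℝ) < q * ∑ h ∈ Finset.range (M₁ + 1), (h : ℝ) * μ₁ h
  · by_cases h2 : (d : ℝ) < q * ∑ h ∈ Finset.range (M₂ + 1), (h : ℝ) * μ₂ h
    · exact gate_lconv_row_of_lt_min y q M₁ M₂ d μ₁ μ₂ hy0 hy1 hq0 hq1 n1 z1 s1 t1 n2 z2 s2 t2 c1 c2 h1 h2
    · exact gate_lconv_row_of_ge_right y q M₁ M₂ d μ₁ μ₂ hy hy1 hq0 hq1 n1 z1 s1 n2 z2 s2 c1 c2 (not_lt.mp h2) hd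
  · -- `q·T₁ ≤ d`: swap the factors
    have hsw := gate_lconv_row_of_ge_right y q M₂ M₁ d μ₂ μ₁ hy hy1 hq0 hq1 n2 z2 s2 n1 z1 s1 c2 c1 (not_lt.mp h1)
      (by rw [add_comm]; exact hd)
    rw [lconv_comm M₂ M₁ μ₂ μ₁, Nat.add_comm M₂ M₁, add_comm (∑ h ∈ Finset.range (M₂ + 1), (h : ℝ) * μ₂ h)] at hsw
    exact hsw

end LawDec

end Quant

end Summit.CriticalPhenomena.PercolationContinuityZ3.Theorems
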